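import Summits.QuantumFields.YangMills.Theorems.FluctuationComparisonRegPrIntLS2BetaIterAxialGaugeOneLevel
import Literature.MathematicalPhysics.QuantumFieldTheory.Balaban1983to89.T3ConstrainedMinimiser
import Literature.MathematicalPhysics.QuantumFieldTheory.Balaban1983to89.T3UnitScaleTilt
import Summits.QuantumFields.YangMills.Theorems.FluctuationComparisonRegPrIntLS2BetaThresholdSum
import HarnessLib

/-!
# THE ITERATED RESIDUAL AXIAL GAUGE SUP LEMMA: top-down comb gauging makes EVERY level of a good history bondwise `O(L²·Σ_{i≥j} θ_i)`-small
# (crux `FluctuationComparisonRegPrIntL`, stmt-QuantumFields-20520; registry v11.4 `Cruxes/FluctuationComparisonRegPrIntL/Lines/semiclassical_s2beta.lean` 3732b7df FROZEN, untouched)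

Cell `ym3-torus` (YM ladder rung R3 = continuum `SU(2)` Yang–Mills on the three-torus — a RUNG: NOT d = 4, NOT infinite volume, NOT a mass gap, NOT Clay).
Width seat `ym3-torus-px10` (gen 21); `--kind proof --supports stmt-QuantumFields-20520 --as helper`, count-neutral, DEFINITION-FREE (0 `def`, 0 `instance`,
0 `notation`, 0 `sorry`, default heartbeats).

THE LEMMA (px8 g21 UV3-NODE §57.7; px12 g22 note v4 §7 «(α) retired»; px12 06:34Z∕06:38Z: pen px10, «expose the gauge», comb convention of
✓`Prop7AxialGauge`).  Heights `j = 0, …, m` of ONE torus `P` of the `Setup` tower (`m ≤ m_P + K_P`), averaged fields `U_j := M^j(U)` (the (0.4) block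
averaging with ANY small-loop average for the algebra, `ℰp = exp[mean log]` on `SU(N)` for the numbers), a family of gauges `g_j : T^{(j)} → G` with
    `g_m ≡ 1`  and  `g_j(x) = g_{j+1}(blockOf x) · U_j(Γ_{emb(blockOf x), x})`  for `j < m`                                         (REC)
(the ITERATED RESIDUAL COMB-AXIAL GAUGE `Ax_k(𝔅_k, 1)` of [Balaban1985RegularSpaces] (1.19), read top-down).  AS PRINTED this is the iteration of
[Balaban1985RegularSpaces] Lemma 1 (1.24)–(1.25) down the levels, p. 87 (1.65): «we apply Lemma 1 to `V₀ = U₀^{k−1}` … and obtain `|U′^{k−1} − 1| < 8d²α₀ + α₁`.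
We apply again the Lemma 1 … with the constant `α₁` replaced by `8d²α₀ + α₁` … Continuing these arguments we get `|U′^j − 1| < 8d²α₀L^{−2(k−j−1)} + … + 8d²α₀ + α₁`»
— there in the regular-space scaling `|∂U^j − 1| < α₀L^{2j}η²`; here with an arbitrary threshold profile `θ_j` (the tree's good histories).  Then:
* §1 SUCH A FAMILY EXISTS (`exists_iterAxialGauge`, for ANY prescribed comb factors `A_j` — so px8 §57.8 (B)'s variant «relative to a lifted background» is a
  re-instantiation; `iterGauge_emb_of_factor`), restricts along the centres `g_j ∘ emb = g_{j+1}` (`iterAxialGauge_emb`), and is COVARIANT along the tower: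
  `M^j(g_0 • U) = g_j • U_j` (`iter_gaugeAct_of_emb`) — in particular `g_0` is RESIDUAL for the `m`-fold average (`M^m(g_0 • U) = U_m`).
* §2 ★★★ `dist1_iterAxialGauge_le` — if `U_i` has `θ_i`-small plaquettes for every `i < m` (the tree's `histGood` shape), the loop guards
  `(((d+2)L)²∕4)·θ_i < δ_N`, `≤ 1∕6` hold, and the top average is flat (`U_m = 1`, the fibre of the flat datum), then at EVERY height `j ≤ m`
  EVERY bond of `g_j • U_j` is within `C_P · Σ_{i ∈ [j,m)} θ_i` of `1`, `C_P = ((d+2)L)²∕2 + (d(L−1)+L+1)²∕4` (`d = 3`: `12.5L² + (2L−1)²`): the one-level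
  letters of ✓`…IterAxialGaugeOneLevel` (interior: comb-fan Stokes; face: next level's bond + correction factor (lit ✓`dist1_corr_le_two_mul` ∘
  ✓`LatticeWordStokes.dist1_loopHol_le`) + crude Stokes of the closed face word) summed down the tower — `m`-UNIFORM when `θ` is summable.
* §3 THE `T³` READING (`F : T3Family`, runs `J ≤ K`, `m = K − J`, `θ_i = θBal L γ b₀ p₀ (K − i)`): for `U ∈ fibre_{J,K}(1) ∩ histGood(θBal) K J`
  (`descendTo = fieldShift ∘ M^{K−J}`, so the top average is `1`: `iter_eq_one_of_mem_fibre_one`) the hypotheses of §2 are the good-history thresholds,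
  and with ✓`…S2BetaThresholdSum.thresholdSum_small`'s shape the bound is `≤ δ` at every level for `γ ≤ γ₁(L, b₀, p₀, δ)` — VOLUME- AND DEPTH-FREE
  (`dist1_iterAxialGauge_le_T3`, `exists_gamma_iterAxialGauge_le_T3`).
WHY IT MATTERS (px8 §57.7 (3)): after this gauge every object the telescoped `hFlat` road interpolates is a level-`j` quantity of size `≪ √2`, so the root
chains ✓(8)∕(9) never leave their non-expanding ball — the located obstacle (α) of the one-shot finest-level gauge ((12d)) does not arise.

HONEST: an induction BY NAME over landed one-level letters; the constant is crude (Stokes `|w|²∕4`, not the area); nothing of Bałaban's analysis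
([Balaban1985RegularSpaces] Lemma 1 ∕ Thm 2 live in the regular-space scaling `e·L^{−2k}`; this is the good-history scaling); `hFlat`, TUBE-REG∘, GAP♯∘, S2β,
crux 20520 NOT proved; no registered stub is closed; rung R3 = SU(2) YM₃ on T³ — NOT d = 4, NOT infinite volume, NOT a mass gap, NOT Clay; the Yang–Mills mass
gap is NOT proved.  Sorry-free, axioms standard.

References: T. Bałaban, CMP **99** (1985) 75–102 [Balaban1985RegularSpaces] ((1.19) p.79, Lemma 1 (1.24)–(1.26) pp.79–80, (1.29) p.81, (1.65) p.87); CMP **98** (1985) 17–51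
[Balaban1985Averaging] ((8)–(13) p.19, pp.24–25); CMP **109** (1987) 249–301 [Balaban1987RG1] ((0.4)–(0.11) p.253, (0.18) p.255); CMP **102** (1985) 255–275
[Balaban1985UV3] ((7) p.257: the small-field history).
-/

set_option autoImplicit false

namespace Summit.QuantumFields.YangMills.Theorems.FluctuationComparisonRegPrIntLS2BetaIterAxialGaugeSup

open Literature.MathematicalPhysics.QuantumFieldTheory.Balaban1983to89
open T4Continuum BlockAveraging LatticeWordStokes
open B10Eq27TorusAxialLog (axialT axialT_self)
open Summit.QuantumFields.YangMills.Theorems.FluctuationComparisonRegPrIntLS2BetaIterAxialGaugeOneLevel (comb_emb dist1_gaugeAct_le_of_coarse)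

variable {P : Params}

/-! ## §1 The gauge family: existence, restriction along the centres, covariance along the tower -/

section Family

variable {G : Type*} [GaugeGroup G]

/-- **THE ITERATED COMB-AXIAL GAUGE EXISTS** for ANY prescribed comb factors `A_j : T^{(j)} → G` (for (REC): `A_j x = U_j(Γ_{emb(blockOf x),x})`; for px8 §57.8 (B)'s
gauge RELATIVE to a lifted background: that times the background's comb holonomy inverted) — downward recursion from `g_m ≡ 1`, the gauge `1` at heights `≥ m`.
Proof: induction on the codepth — extend a family satisfying the recursion on `[m−t, m)` to `[m−t−1, m)` by redefining the single height `m−t−1`.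
[cite: Balaban1985RegularSpaces, (1.19) p.79] -/
theorem exists_iterAxialGauge (m : ℕ) (A : (j : ℕ) → Site P j → G) :
    ∃ g : (j : ℕ) → Site P j → G, (∀ j, m ≤ j → ∀ y, g j y = 1) ∧
      ∀ j, j < m → ∀ x, g j x = g (j + 1) (blockOf x) * A j x := by
  suffices h : ∀ t : ℕ, ∃ g : (j : ℕ) → Site P j → G, (∀ j, m ≤ j → ∀ y, g j y = 1) ∧
      ∀ j, j < m → m ≤ j + t → ∀ x, g j x = g (j + 1) (blockOf x) * A j x by
    obtain ⟨g, h1, h2⟩ := h m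
    exact ⟨g, h1, fun j hj x => h2 j hj (by omega) x⟩
  intro t
  induction t with
  | zero => exact ⟨fun _ _ => 1, fun _ _ _ => rfl, fun j hj hjt _ => by omega⟩
  | succ t ih =>
    obtain ⟨g, h1, h2⟩ := ih
    classical
    refine ⟨fun j => if j + (t + 1) = m then fun x => g (j + 1) (blockOf x) * A j x else g j, ?_, ?_⟩
    · intro j hj y
      have hne : ¬ (j + (t + 1) = m) := by omega
      simp only [hne, if_false]
      exact h1 j hj y
    · intro j hj hjt x
      by_cases hjm : j + (t + 1) = m
      · have hne : ¬ (j + 1 + (t + 1) = m) := by omega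
        simp only [hjm, if_true, hne, if_false]
      · have hne : ¬ (j + 1 + (t + 1) = m) := by omega
        simp only [hjm, if_false, hne]
        exact h2 j hj (by omega) x

/-- **THE RECURSION RESTRICTS ALONG THE CENTRES** whenever the comb factors are `1` at the centres: `g_j (emb y) = g_{j+1} y` for `j < m` (standing range).
[cite: Balaban1985RegularSpaces, (1.19) p.79] -/
theorem iterGauge_emb_of_factor {m : ℕ} (hm : m ≤ P.m + P.K) (A : (j : ℕ) → Site P j → G) (hA : ∀ j, j < m → ∀ y : Site P (j + 1), A j (emb y) = 1)
    (g : (j : ℕ) → Site P j → G) (hrec : ∀ j, j < m → ∀ x, g j x = g (j + 1) (blockOf x) * A j x)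
    {j : ℕ} (hj : j < m) (y : Site P (j + 1)) : g j (emb y) = g (j + 1) y := by
  rw [hrec j hj, Site.blockOf_emb (by omega), hA j hj y, mul_one]

/-- **(REC) RESTRICTS ALONG THE CENTRES**: `g_j (emb y) = g_{j+1} y` for `j < m` (empty comb; standing range). [cite: Balaban1985RegularSpaces, (1.19) p.79] -/
theorem iterAxialGauge_emb {m : ℕ} (hm : m ≤ P.m + P.K) (V : (j : ℕ) → GaugeField P j G) (g : (j : ℕ) → Site P j → G)
    (hrec : ∀ j, j < m → ∀ x, g j x = g (j + 1) (blockOf x) * axialT (V j) (emb (blockOf x)) x)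
    {j : ℕ} (hj : j < m) (y : Site P (j + 1)) : g j (emb y) = g (j + 1) y :=
  comb_emb (by omega) (V j) (g j) (g (j + 1)) (hrec j hj) y

/-- **COVARIANCE ALONG THE TOWER** ([Balaban1985Averaging] (11) iterated): if `g_j ∘ emb = g_{j+1}` for `j < m` then `M^j(g_0 • U) = g_j • M^j(U)` for every
`j ≤ m` (any family of averagings `av`). [cite: Balaban1985Averaging, (11)-(13) p.19] -/
theorem iter_gaugeAct_of_emb (av : ∀ i, Averaging P i G) {m : ℕ} (hm : m ≤ P.m + P.K) (g : (j : ℕ) → Site P j → G)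
    (hemb : ∀ j, j < m → ∀ y : Site P (j + 1), g j (emb y) = g (j + 1) y) (U : GaugeField P 0 G) :
    ∀ j, j ≤ m → Averaging.iter av j (GaugeField.gaugeAct (g 0) U) = GaugeField.gaugeAct (g j) (Averaging.iter av j U)
  | 0, _ => rfl
  | j + 1, hj => by
    show (av j).avg (Averaging.iter av j (GaugeField.gaugeAct (g 0) U)) = GaugeField.gaugeAct (g (j + 1)) ((av j).avg (Averaging.iter av j U))
    rw [iter_gaugeAct_of_emb av hm g hemb U j (by omega), (av j).covariant (by omega)]
    congr 1
    funext y
    exact hemb j (by omega) y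

/-- **THE BOTTOM GAUGE IS RESIDUAL**: under (REC) with `g_m ≡ 1`, `M^m(g_0 • U) = M^m(U)` — `g_0` lies in print's group (4) of the `m`-fold average.
[cite: Balaban1985Variational, (4) p.278; Balaban1985Averaging, (11) p.19] -/
theorem iter_gaugeAct_eq_of_top (av : ∀ i, Averaging P i G) {m : ℕ} (hm : m ≤ P.m + P.K) (V : (j : ℕ) → GaugeField P j G)
    (g : (j : ℕ) → Site P j → G) (htop : ∀ y, g m y = 1)
    (hrec : ∀ j, j < m → ∀ x, g j x = g (j + 1) (blockOf x) * axialT (V j) (emb (blockOf x)) x) (U : GaugeField P 0 G) :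
    Averaging.iter av m (GaugeField.gaugeAct (g 0) U) = Averaging.iter av m U := by
  rw [iter_gaugeAct_of_emb av hm g (fun j hj y => iterAxialGauge_emb hm V g hrec hj y) U m le_rfl]
  have h1 : g m = 1 := funext htop
  rw [h1]
  funext b
  simp [GaugeField.gaugeAct]

end Family

/-! ## §2 The sup lemma on `SU(N)` with the (0.4) average `exp[mean log]` -/

section Sup

open ExpMeanLog BlockAveragingEMLProp2
open scoped Matrix.Norms.L2Operator

variable {n : Type*} [Fintype n] [DecidableEq n] [Nonempty n]

/-- ★★★ **THE ITERATED RESIDUAL AXIAL GAUGE SUP LEMMA.**  Heights `j ≤ m ≤ m_P + K_P` of one torus; `U_j := M^j(U)` the `j`-fold (0.4) averages with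
`ℰp = exp[mean log]` on `SU(N)`; `θ_i ≥ 0` with `PlaqSmall (θ_i) U_i` for `i < m` and the loop guards `(((d+2)L)²∕4)·θ_i < δ_N`, `≤ 1∕6`; the top average
FLAT (`U_m = 1`); `g` the iterated comb-axial gauge ((REC), `g_m ≡ 1`).  Then for every `j ≤ m` and every bond `b` of height `j`,
`dist1((g_j • U_j) b) ≤ (((d+2)L)²∕2 + (d(L−1)+L+1)²∕4) · Σ_{i ∈ [j, m)} θ_i`.  Proof: downward induction `s_j ≤ s_{j+1} + C_P·θ_j`, `s_m = 0`, by
✓`…IterAxialGaugeOneLevel.dist1_gaugeAct_le_of_coarse` with `Ū_j = U_{j+1}` (definition of the iterate) and the correction factor bounded by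
`2·(((d+2)L)²∕4)·θ_j`. [cite: Balaban1985RegularSpaces, Lemma 1 (1.24)-(1.25) p.79 and (1.65) p.87; Balaban1987RG1, (0.4) p.253] -/
theorem dist1_iterAxialGauge_le {m : ℕ} (hm : m ≤ P.m + P.K) (U : GaugeField P 0 (Matrix.specialUnitaryGroup n ℂ))
    (θ : ℕ → ℝ) (hθ0 : ∀ i, 0 ≤ θ i)
    (hθ : ∀ i, i < m → PlaqSmall (θ i) (Averaging.iter (fun k => blockAvg (P := P) (j := k) (expMeanLogSU (n := n))) i U))
    (hguard : ∀ i, i < m → ((((P.d + 2) * P.L : ℕ) : ℝ) ^ 2 / 4) * θ i < deltaSU n ∧ ((((P.d + 2) * P.L : ℕ) : ℝ) ^ 2 / 4) * θ i ≤ 1 / 6)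
    (htopU : Averaging.iter (fun k => blockAvg (P := P) (j := k) (expMeanLogSU (n := n))) m U = 1)
    (g : (j : ℕ) → Site P j → Matrix.specialUnitaryGroup n ℂ) (htop : ∀ y, g m y = 1)
    (hrec : ∀ j, j < m → ∀ x, g j x = g (j + 1) (blockOf x) *
      axialT (Averaging.iter (fun k => blockAvg (P := P) (j := k) (expMeanLogSU (n := n))) j U) (emb (blockOf x)) x) :
    ∀ j, j ≤ m → ∀ b : PBond P j,
      dist1 (GaugeField.gaugeAct (g j) (Averaging.iter (fun k => blockAvg (P := P) (j := k) (expMeanLogSU (n := n))) j U) b) ≤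
        ((((P.d + 2) * P.L : ℕ) : ℝ) ^ 2 / 2 + (((P.d * (P.L - 1) + P.L + 1 : ℕ) : ℝ) ^ 2 / 4)) * ∑ i ∈ Finset.Ico j m, θ i := by
  set av : ∀ k, Averaging P k (Matrix.specialUnitaryGroup n ℂ) := fun k => blockAvg (P := P) (j := k) (expMeanLogSU (n := n)) with hav
  set C : ℝ := (((P.d + 2) * P.L : ℕ) : ℝ) ^ 2 / 2 + (((P.d * (P.L - 1) + P.L + 1 : ℕ) : ℝ) ^ 2 / 4) with hC
  have hC0 : 0 ≤ C := by positivity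
  -- downward induction on the codepth `t = m − j`
  suffices H : ∀ t j, j + t = m → ∀ b : PBond P j,
      dist1 (GaugeField.gaugeAct (g j) (Averaging.iter av j U) b) ≤ C * ∑ i ∈ Finset.Ico j m, θ i by
    intro j hj b; exact H (m - j) j (by omega) b
  intro t
  induction t with
  | zero =>
    intro j hjm b
    rw [add_zero] at hjm
    subst hjm
    have h1 : g j = 1 := funext htop
    rw [htopU, h1]
    have h0 : GaugeField.gaugeAct (1 : Site P j → Matrix.specialUnitaryGroup n ℂ) (1 : GaugeField P j (Matrix.specialUnitaryGroup n ℂ)) b = 1 := by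
      have hb1 : (1 : GaugeField P j (Matrix.specialUnitaryGroup n ℂ)) b = 1 := rfl
      simp [GaugeField.gaugeAct, hb1]
    rw [h0, GaugeGroup.dist1_one, Finset.Ico_self, Finset.sum_empty, mul_zero]
  | succ t ih =>
    intro j hjm b
    have hjm' : j < m := by omega
    have hj1 : j + 1 ≤ P.m + P.K := by omega
    -- the induction hypothesis one level up, read on `Ū_j = U_{j+1}`
    have hs' : ∀ c : PBond P (j + 1), dist1 (GaugeField.gaugeAct (g (j + 1)) (avgFun (expMeanLogSU (n := n)) (Averaging.iter av j U)) c) ≤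
        C * ∑ i ∈ Finset.Ico (j + 1) m, θ i := fun c => ih (j + 1) (by omega) c
    -- the correction factors of level `j`
    have hloop : ∀ (c : PBond P (j + 1)) (i : Idx P), dist1 (loopHol (Averaging.iter av j U) c i) ≤ ((((P.d + 2) * P.L : ℕ) : ℝ) ^ 2 / 4) * θ j :=
      fun c i => dist1_loopHol_le (hθ0 j) (hθ j hjm') c i
    have hκ : ∀ c : PBond P (j + 1), dist1 (corr (expMeanLogSU (n := n)) (Averaging.iter av j U) c) ≤ 2 * (((((P.d + 2) * P.L : ℕ) : ℝ) ^ 2 / 4) * θ j) :=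
      fun c => dist1_corr_le_two_mul _ c (hloop c) (hguard j hjm').1 (hguard j hjm').2
    have hs'0 : 0 ≤ C * ∑ i ∈ Finset.Ico (j + 1) m, θ i := mul_nonneg hC0 (Finset.sum_nonneg fun i _ => hθ0 i)
    have hκ0 : 0 ≤ 2 * (((((P.d + 2) * P.L : ℕ) : ℝ) ^ 2 / 4) * θ j) := by have := hθ0 j; positivity
    have h := dist1_gaugeAct_le_of_coarse hj1 (expMeanLogSU (n := n)) (Averaging.iter av j U) (hθ0 j) (hθ j hjm') (g j) (g (j + 1))
      (hrec j hjm') hs'0 hκ0 hs' hκ b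
    rw [Finset.sum_eq_sum_Ico_succ_bot hjm', mul_add]
    have hsplit : C * θ j = 2 * (((((P.d + 2) * P.L : ℕ) : ℝ) ^ 2 / 4) * θ j) + ((((P.d * (P.L - 1) + P.L + 1 : ℕ) : ℝ) ^ 2 / 4) * θ j) := by
      rw [hC]; ring
    linarith

/-- **PACKAGED WITH THE EXISTENCE**: under the hypotheses of `dist1_iterAxialGauge_le` on `U` there IS a family `g` — `g_m ≡ 1`, (REC), restricting along
the centres, `g_0` residual (`M^m(g_0 • U) = 1`), covariant (`M^j(g_0 • U) = g_j • U_j`) — in which every level is bondwise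
`C_P·Σ_{i∈[j,m)} θ_i`-small. [cite: Balaban1985RegularSpaces, (1.19) p.79 and (1.65) p.87] -/
theorem exists_iterAxialGauge_le {m : ℕ} (hm : m ≤ P.m + P.K) (U : GaugeField P 0 (Matrix.specialUnitaryGroup n ℂ))
    (θ : ℕ → ℝ) (hθ0 : ∀ i, 0 ≤ θ i)
    (hθ : ∀ i, i < m → PlaqSmall (θ i) (Averaging.iter (fun k => blockAvg (P := P) (j := k) (expMeanLogSU (n := n))) i U))
    (hguard : ∀ i, i < m → ((((P.d + 2) * P.L : ℕ) : ℝ) ^ 2 / 4) * θ i < deltaSU n ∧ ((((P.d + 2) * P.L : ℕ) : ℝ) ^ 2 / 4) * θ i ≤ 1 / 6)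
    (htopU : Averaging.iter (fun k => blockAvg (P := P) (j := k) (expMeanLogSU (n := n))) m U = 1) :
    ∃ g : (j : ℕ) → Site P j → Matrix.specialUnitaryGroup n ℂ,
      (∀ j, m ≤ j → ∀ y, g j y = 1) ∧
      (∀ j, j < m → ∀ x, g j x = g (j + 1) (blockOf x) *
        axialT (Averaging.iter (fun k => blockAvg (P := P) (j := k) (expMeanLogSU (n := n))) j U) (emb (blockOf x)) x) ∧
      (∀ j, j < m → ∀ y : Site P (j + 1), g j (emb y) = g (j + 1) y) ∧
      Averaging.iter (fun k => blockAvg (P := P) (j := k) (expMeanLogSU (n := n))) m (GaugeField.gaugeAct (g 0) U) = 1 ∧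
      (∀ j, j ≤ m → Averaging.iter (fun k => blockAvg (P := P) (j := k) (expMeanLogSU (n := n))) j (GaugeField.gaugeAct (g 0) U) =
        GaugeField.gaugeAct (g j) (Averaging.iter (fun k => blockAvg (P := P) (j := k) (expMeanLogSU (n := n))) j U)) ∧
      ∀ j, j ≤ m → ∀ b : PBond P j,
        dist1 (GaugeField.gaugeAct (g j) (Averaging.iter (fun k => blockAvg (P := P) (j := k) (expMeanLogSU (n := n))) j U) b) ≤
          ((((P.d + 2) * P.L : ℕ) : ℝ) ^ 2 / 2 + (((P.d * (P.L - 1) + P.L + 1 : ℕ) : ℝ) ^ 2 / 4)) * ∑ i ∈ Finset.Ico j m, θ i := by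
  obtain ⟨g, htop, hrec⟩ := exists_iterAxialGauge (G := Matrix.specialUnitaryGroup n ℂ) m
    (fun j x => axialT (Averaging.iter (fun k => blockAvg (P := P) (j := k) (expMeanLogSU (n := n))) j U) (emb (blockOf x)) x)
  have hemb : ∀ j, j < m → ∀ y : Site P (j + 1), g j (emb y) = g (j + 1) y := fun j hj y => iterAxialGauge_emb hm _ g hrec hj y
  refine ⟨g, htop, hrec, hemb, ?_, iter_gaugeAct_of_emb _ hm g hemb U, dist1_iterAxialGauge_le hm U θ hθ0 hθ hguard htopU g (htop m le_rfl) hrec⟩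
  rw [iter_gaugeAct_eq_of_top _ hm _ g (htop m le_rfl) hrec U, htopU]

end Sup

/-! ## §3 The `T³` reading: good histories over the flat datum -/

section T3

open T3ContinuumYM3Torus T3UnitLawDensityEML T3TiltDescent T3ConstrainedMinimiser T3UnitScaleTilt T3LevelShift
open scoped Matrix.Norms.L2Operator

variable (F : T3Family)

/-- **A FIBRE ELEMENT OVER THE FLAT DATUM HAS A FLAT TOP AVERAGE**: `D_{J,K} U = 1 ⟹ M^{K−J}(U) = 1` (`descendTo` is `fieldShift ∘ M^{K−J}` and `fieldShift`
only relabels bonds). [cite: Balaban1987RG1, (0.11) p.253] -/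
theorem iter_eq_one_of_mem_fibre_one {J K : ℕ} (hJK : J ≤ K) {U : GaugeField (F.P K) 0 (Matrix.specialUnitaryGroup (Fin 2) ℂ)}
    (hU : U ∈ fibre F ℰp J K hJK 1) :
    Averaging.iter (fun k => blockAvg (P := F.P K) (j := k) ℰp) (K - J) U = 1 := by
  have h : fieldShift (F.sitesPerDir_eq (m := F.m) (K := J) (j := 0) (m' := F.m) (K' := K) (j' := K - J) (by omega))
      (Averaging.iter (fun k => blockAvg (P := F.P K) (j := k) ℰp) (K - J) U) = 1 := hU
  funext b
  have hb := congrFun h ((bondShift (F.sitesPerDir_eq (m := F.m) (K := J) (j := 0) (m' := F.m) (K' := K) (j' := K - J) (by omega))).symm b)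
  rw [fieldShift_apply, Equiv.apply_symm_apply] at hb
  exact hb

/-- ★★★ **THE SUP LEMMA ON A GOOD HISTORY OVER THE FLAT DATUM** (runs `J ≤ K` of a `T3Family`, `m = K − J`, thresholds `θ_i = θBal L γ b₀ p₀ (K − i)` of the
tree's `histGood`): for `U ∈ fibre_{J,K}(1) ∩ histGood(θBal) K J` and thresholds satisfying the loop guards `((5L)²∕4)·θBal(K−i) < δ₂`, `≤ 1∕6` (`i < K − J`),
there is an iterated comb-axial gauge `g` (`g_{K−J} ≡ 1`, (REC), residual, covariant) with EVERY bond of EVERY level `j ≤ K − J` of the gauged history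
within `(25L²∕2 + (2L−1)²)·Σ_{i∈[j,K−J)} θBal(K − i)` of `1`. [cite: Balaban1985RegularSpaces, (1.65) p.87; Balaban1985UV3, (7) p.257] -/
theorem exists_iterAxialGauge_le_T3 {J K : ℕ} (hJK : J ≤ K) {γ b₀ p₀ : ℝ}
    (hθ0 : ∀ i, 0 ≤ θBal F.L γ b₀ p₀ i)
    (hguard : ∀ i, i < K - J → ((((3 + 2) * F.L : ℕ) : ℝ) ^ 2 / 4) * θBal F.L γ b₀ p₀ (K - i) < ExpMeanLog.deltaSU (Fin 2) ∧
      ((((3 + 2) * F.L : ℕ) : ℝ) ^ 2 / 4) * θBal F.L γ b₀ p₀ (K - i) ≤ 1 / 6)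
    {U : GaugeField (F.P K) 0 (Matrix.specialUnitaryGroup (Fin 2) ℂ)}
    (hUf : U ∈ fibre F ℰp J K hJK 1) (hUg : U ∈ histGood F ℰp (θBal F.L γ b₀ p₀) K J) :
    ∃ g : (j : ℕ) → Site (F.P K) j → Matrix.specialUnitaryGroup (Fin 2) ℂ,
      (∀ j, K - J ≤ j → ∀ y, g j y = 1) ∧
      (∀ j, j < K - J → ∀ x, g j x = g (j + 1) (blockOf x) *
        axialT (Averaging.iter (fun k => blockAvg (P := F.P K) (j := k) ℰp) j U) (emb (blockOf x)) x) ∧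
      (∀ j, j < K - J → ∀ y : Site (F.P K) (j + 1), g j (emb y) = g (j + 1) y) ∧
      Averaging.iter (fun k => blockAvg (P := F.P K) (j := k) ℰp) (K - J) (GaugeField.gaugeAct (g 0) U) = 1 ∧
      (∀ j, j ≤ K - J → Averaging.iter (fun k => blockAvg (P := F.P K) (j := k) ℰp) j (GaugeField.gaugeAct (g 0) U) =
        GaugeField.gaugeAct (g j) (Averaging.iter (fun k => blockAvg (P := F.P K) (j := k) ℰp) j U)) ∧
      ∀ j, j ≤ K - J → ∀ b : PBond (F.P K) j,
        dist1 (GaugeField.gaugeAct (g j) (Averaging.iter (fun k => blockAvg (P := F.P K) (j := k) ℰp) j U) b) ≤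
          ((((3 + 2) * F.L : ℕ) : ℝ) ^ 2 / 2 + (((3 * (F.L - 1) + F.L + 1 : ℕ) : ℝ) ^ 2 / 4)) *
            ∑ i ∈ Finset.Ico j (K - J), θBal F.L γ b₀ p₀ (K - i) := by
  have hm : K - J ≤ (F.P K).m + (F.P K).K := by show K - J ≤ F.m + K; omega
  have hθ : ∀ i, i < K - J → PlaqSmall (θBal F.L γ b₀ p₀ (K - i)) (Averaging.iter (fun k => blockAvg (P := F.P K) (j := k) ℰp) i U) :=
    fun i hi => hUg i (by omega)
  exact exists_iterAxialGauge_le (P := F.P K) (n := Fin 2) hm U (fun i => θBal F.L γ b₀ p₀ (K - i)) (fun i => hθ0 _) hθ hguard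
    (iter_eq_one_of_mem_fibre_one F hJK hUf)

/-- ★★★ **VOLUME- AND DEPTH-FREE FORM**: for every block size `L > 1`, profile `(b₀, p₀)` and target `δ > 0` there is `γ₁ = γ₁(L, b₀, p₀, δ) > 0` such
that for every `T³`-family with `F.L = L`, every coupling `0 < γ ≤ γ₁`, every pair of runs `J ≤ K` and every `U ∈ fibre_{J,K}(1) ∩ histGood(θBal) K J`, the
iterated comb-axial gauge makes EVERY bond of EVERY level `j ≤ K − J` of the history `δ`-close to `1` (the loop guards and `C_P·Σ_i θBal(K−i) ≤ δ` are
✓`…S2BetaThresholdSum.thresholdSum_small`: the thresholds are geometric in the level). [cite: Balaban1985RegularSpaces, (1.65) p.87; Balaban1985UV3, (7) p.257] -/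
theorem exists_gamma_iterAxialGauge_le_T3 (L : ℕ) (hL : 1 < L) (b₀ p₀ : ℝ) (hb : 0 < b₀) (hp : 0 < p₀) (δ : ℝ) (hδ : 0 < δ) :
    ∃ γ₁ : ℝ, 0 < γ₁ ∧ ∀ (F : T3Family) (γ : ℝ), F.L = L → 0 < γ → γ ≤ γ₁ → ∀ (J K : ℕ) (hJK : J ≤ K)
      (U : GaugeField (F.P K) 0 (Matrix.specialUnitaryGroup (Fin 2) ℂ)),
      U ∈ fibre F ℰp J K hJK 1 → U ∈ histGood F ℰp (θBal F.L γ b₀ p₀) K J →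
      ∃ g : (j : ℕ) → Site (F.P K) j → Matrix.specialUnitaryGroup (Fin 2) ℂ,
        (∀ j, K - J ≤ j → ∀ y, g j y = 1) ∧
        (∀ j, j < K - J → ∀ x, g j x = g (j + 1) (blockOf x) *
          axialT (Averaging.iter (fun k => blockAvg (P := F.P K) (j := k) ℰp) j U) (emb (blockOf x)) x) ∧
        (∀ j, j < K - J → ∀ y : Site (F.P K) (j + 1), g j (emb y) = g (j + 1) y) ∧
        Averaging.iter (fun k => blockAvg (P := F.P K) (j := k) ℰp) (K - J) (GaugeField.gaugeAct (g 0) U) = 1 ∧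
        (∀ j, j ≤ K - J → Averaging.iter (fun k => blockAvg (P := F.P K) (j := k) ℰp) j (GaugeField.gaugeAct (g 0) U) =
          GaugeField.gaugeAct (g j) (Averaging.iter (fun k => blockAvg (P := F.P K) (j := k) ℰp) j U)) ∧
        ∀ j, j ≤ K - J → ∀ b : PBond (F.P K) j,
          dist1 (GaugeField.gaugeAct (g j) (Averaging.iter (fun k => blockAvg (P := F.P K) (j := k) ℰp) j U) b) ≤ δ := by
  set C : ℝ := (((3 + 2) * L : ℕ) : ℝ) ^ 2 / 2 + (((3 * (L - 1) + L + 1 : ℕ) : ℝ) ^ 2 / 4) with hC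
  have hC0 : 0 ≤ C := by positivity
  set q : ℝ := (((3 + 2) * L : ℕ) : ℝ) ^ 2 / 4 with hq
  have hq0 : 0 < q := by
    have h5 : (0 : ℝ) < (((3 + 2) * L : ℕ) : ℝ) := by
      have : 0 < (3 + 2) * L := by omega
      exact_mod_cast this
    positivity
  set a₀ : ℝ := min (ExpMeanLog.deltaSU (Fin 2) / 2) (1 / 6) / q with ha₀
  have hδSU := ExpMeanLog.deltaSU_pos (n := Fin 2)
  have ha₀pos : 0 < a₀ := div_pos (lt_min (by linarith) (by norm_num)) hq0
  obtain ⟨γ₁, hγ₁, hts⟩ := FluctuationComparisonRegPrIntLS2BetaThresholdSum.thresholdSum_small L hL b₀ p₀ hb hp C a₀ δ hC0 ha₀pos hδ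
  refine ⟨γ₁, hγ₁, fun F γ hFL hγ hγle J K hJK U hUf hUg => ?_⟩
  obtain ⟨h1, h2⟩ := hts γ hγ hγle
  subst hFL
  have hguard : ∀ i, i < K - J → ((((3 + 2) * F.L : ℕ) : ℝ) ^ 2 / 4) * θBal F.L γ b₀ p₀ (K - i) < ExpMeanLog.deltaSU (Fin 2) ∧
      ((((3 + 2) * F.L : ℕ) : ℝ) ^ 2 / 4) * θBal F.L γ b₀ p₀ (K - i) ≤ 1 / 6 := by
    intro i _
    have hle : q * θBal F.L γ b₀ p₀ (K - i) ≤ q * a₀ := mul_le_mul_of_nonneg_left (h1 (K - i)).2 hq0.le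
    have hqa : q * a₀ = min (ExpMeanLog.deltaSU (Fin 2) / 2) (1 / 6) := by rw [ha₀]; field_simp
    rw [hqa] at hle
    exact ⟨lt_of_le_of_lt (hle.trans (min_le_left _ _)) (by linarith), hle.trans (min_le_right _ _)⟩
  obtain ⟨g, hg1, hg2, hg3, hg4, hg5, hg6⟩ := exists_iterAxialGauge_le_T3 F hJK (fun i => (h1 i).1) hguard hUf hUg
  refine ⟨g, hg1, hg2, hg3, hg4, hg5, fun j hj b => (hg6 j hj b).trans ?_⟩
  have hsub : ∑ i ∈ Finset.Ico j (K - J), θBal F.L γ b₀ p₀ (K - i) ≤ ∑ i ∈ Finset.range (K - J), θBal F.L γ b₀ p₀ (K - i) :=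
    Finset.sum_le_sum_of_subset_of_nonneg (fun i hi => by rw [Finset.mem_Ico] at hi; exact Finset.mem_range.2 hi.2) fun i _ _ => (h1 _).1
  calc C * ∑ i ∈ Finset.Ico j (K - J), θBal F.L γ b₀ p₀ (K - i) ≤ C * ∑ i ∈ Finset.range (K - J), θBal F.L γ b₀ p₀ (K - i) :=
        mul_le_mul_of_nonneg_left hsub hC0
    _ ≤ δ := h2 J K hJK

end T3

end Summit.QuantumFields.YangMills.Theorems.FluctuationComparisonRegPrIntLS2BetaIterAxialGaugeSup
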